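/-
Companion file of the Resolution Observatory cell (pub-rosobs), carver generation 48.  Statements OURS (the cell's
LEMMA CF (1)–(2) and LEMMA FP (ii), engine 1 generation 32); pure commutative algebra over an arbitrary commutative
ring, the positive characteristic entering only in the last section.  An INSTRUMENT of the cell's normal-form
bookkeeping for maximal weighted centres — NOT a resolution theorem.
-/
import Literature.AlgebraicGeometry.Resolution.WeightedCentreCleanLayers
import Literature.AlgebraicGeometry.Resolution.WeightedCentreLayerEquation
import Mathlib.Algebra.CharP.Lemmas
import Mathlib.Algebra.MvPolynomial.Derivation
import Mathlib.Algebra.MvPolynomial.PDeriv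
import Mathlib.Algebra.Order.Antidiag.Prod
import Mathlib.Data.Finsupp.Antidiagonal
import Mathlib.Data.Finsupp.Weight
import HarnessLib

/-!
# Constant-field restriction of a derivation (LEMMA CF), the truncated exponential, and two Frobenius identities

Uniform value line: typed identities in the polynomial model the cell's engines compute in — NOT a resolution
theorem, NOT a statement about the ATW invariant on power series, NOT summit progress; AI review is weaker than
expert review.

Setting.  Let `A = R[ε_H]` (`MvPolynomial H R`) and `A[ε_L] = MvPolynomial L (MvPolynomial H R)`; in the cell's
LEMMA CF the variables `ε_N`, `N = H ⊔ L`, of `k[ε_N]` are split into the LIGHT ones `L` (lighter than the lightest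
moved weight class) and the rest `H`, and the dictionary is `MvPolynomial.sumAlgEquiv R L H :
MvPolynomial (L ⊕ H) R ≃ₐ[R] MvPolynomial L (MvPolynomial H R)`.  Let `X` be an `R`-derivation of `A[ε_L]` with NO
components on `L`: `X(ε_l) = 0` for `l ∈ L` (for the logarithmic derivation of a graded isotropy this is automatic,
the `ε_L` being lighter than everything `X` moves).  Expanding `X(a) = Σ_κ ε_L^κ · Z^{(κ)}(a)` (`a ∈ A`) defines the
COEFFICIENT DERIVATIONS `Z^{(κ)} = coeffDerivation X κ` of `A` (§1); if `κ₀` is divisibility-minimal among the `κ`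
with `Z^{(κ)} ≠ 0` — in the graded setting: every such `κ` weighs at least `β = weight κ₀`, which is what the
cell's numerical condition (GAP) provides — then the `ε_L^{κ₀}`-coefficient of `X(g)` is `Z^{(κ₀)}(G_H)`,
`G_H = g|_{ε_L = 0}`, so `X(g) = 0` forces `Z^{(κ₀)}(G_H) = 0`: the face restricted to `ε_L = 0` is killed by a
derivation of `A` whose coefficients are the `κ₀`-coefficients of the `ξ_i = X(ε_i)` — CONSTANTS on the lightest
moved class ("constant-field restriction", LEMMA CF (1)).  A derivation `Z` of `S = A` with a SLICE `u`
(`Z(u) = 1`; in LEMMA CF `u = ε_{i₀}/r_{i₀}` with `Z(ε_{i₀}) = r_{i₀} ∈ k^×`) is rectified by the truncated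
exponential `E_N` (§2): `Z(E_{N+1} f) = (−u)^N Z^{N+1}(f)` (telescoping, over any ring), so every `f` of `Z`-order
`≤ N < p` is corrected by a multiple of `u` into `ker Z`; and if the new coordinates `φ` satisfy `Z(φ_i) = 0`
(`i ≠ i₀`) with `Z(φ_{i₀})` a unit, the chain rule (§3) turns `Z(𝒢(φ)) = 0` into `∂_{i₀}𝒢 = 0`, i.e. in
characteristic `p` into `𝒢 ∈ k[φ_{≠ i₀}][φ_{i₀}^p]` (LEMMA CF (2)).  §4–§5 record the two Frobenius identities of
the cell's pin-breaking steps: derivations kill `p`-th powers (LEMMA FP (ii): a perturbation `c·ℓ^p` of `g₀` is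
invisible to every derivation read off a substitution, e.g. the clean layers `layerDeriv` of
`WeightedCentreCleanLayers`), and `c·(x + Σ a_i N_i)^p + Σ g_i N_i^p = c·x^p` when `c·a_i^p = −g_i` (LEMMA FA:
Frobenius absorption of `p`-th-power pins).

## Main statements (all derived here, over an arbitrary commutative ring unless `CharP` is displayed)

* `coeffDerivation X κ` (the `Z^{(κ)}`), `coeffDerivation_eq_mkDerivation` (`Z^{(κ)} = Σ_i ξ_i^{(κ)} ∂_i`);
  `coeff_apply_eq_sum_antidiagonal` (CONVOLUTION FORMULA `coeff_ν X(g) = Σ_{κ+μ=ν} Z^{(κ)}(g_μ)` when `X(ε_L) = 0`);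
  `coeff_zero_apply` (`β = 0`); `coeff_apply_of_forall_lt_eq_zero` and `coeffDerivation_coeff_zero_eq_zero`
  (LEMMA CF (1): `coeff_{κ₀} X(g) = Z^{(κ₀)}(G_H)`, hence `X(g) = 0 ⇒ Z^{(κ₀)}(G_H) = 0`, for `κ₀` minimal);
  graded forms `coeff_apply_of_weight_lt`, `coeffDerivation_coeff_zero_eq_zero_of_weight_lt`
  (hypothesis: `Z^{(κ)} = 0` whenever `weight w κ < weight w κ₀`, positive weights `w : L → ℚ`).
* `truncExp Z u N f` (`E_N`), `truncExp_one`, `truncExp_two` (`E_2 f = f − u·Z f`), `apply_truncExp_succ`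
  (TELESCOPING `Z(E_{N+1} f) = (−u)^N Z^{N+1} f` given `Z u = 1`), `apply_truncExp_succ_eq_zero`
  (`Z^{N+1} f = 0 ⇒ E_{N+1} f ∈ ker Z`), `exists_truncExp_succ_eq` (`E_{N+1} f = N!·f + u·v`),
  `apply_units_inv_smul` (slice normalisation `Z(r⁻¹·e) = 1`).
* `apply_aeval_eq_sum` (CHAIN RULE `Z(G(φ)) = Σ_i (∂_i G)(φ)·Z(φ_i)`), `derivation_apply_eq_sum_pderiv_mul`
  (`D = Σ_i D(ε_i) ∂_i`), `layerDeriv_eq_mkDerivation_apply` (bridge: the clean-layer operator `L_s` of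
  `WeightedCentreCleanLayers` is the derivation `mkDerivation R (a_{s,·})`), `apply_aeval_of_forall_ne_eq_zero`,
  `pderiv_eq_zero_of_apply_aeval_eq_zero` (LEMMA CF (2): `∂_{i₀} G = 0`) and, for a field of characteristic `p`,
  `dvd_of_apply_aeval_eq_zero` (`p ∣` every exponent of `ε''_{i₀}` in `G`).
* `derivation_apply_pow_char_eq_zero` (`D(a^p) = 0`), `derivation_apply_add_mul_pow_char`,
  `derivation_apply_add_C_mul_pow_char` (LEMMA FP (ii): `D(g + c·ℓ^p) = D(g)` for constant `c`);
  `add_sum_mul_pow_char`, `frobenius_absorption`, `frobenius_absorption_mvPolynomial` (LEMMA FA core).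

Honest scope.  NOT typed here: (i) the numerical side of LEMMA CF — that the cell's condition (GAP) on the weights
implies `Z^{(κ)} = 0` for `weight κ < β` (it enters as the hypothesis `hK` / `hmin`; the finitely many (GAP) tables
are decidable arithmetic, CARVER-NOTES-eng1-g32 T6); (ii) the coordinate-change half of LEMMA CF (2) — that
`(u, E(ε_i)/N_i!)_{i ≠ i₀}` is again a graded coordinate system with `S = (ker Z)[u]` (it enters as the injectivity
hypothesis `hinj`; the slice theorem [VandenessenKurodaCrachiola2021, Cor. 3.2.10] is cited, not formalised) and
the multiplicativity of the full truncated exponential below `p`; (iii) LEMMA CF (3) (reading off the pins), the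
support bookkeeping of LEMMA FA, PROPOSITION RIG and everything about centres, blow-ups or power series.  The file
`WeightedCentreLayerEquation` supplies `dvd_of_pderiv_eq_zero` (`∂_i G = 0 ⇒ p ∣` exponents).
-/

noncomputable section

open MvPolynomial

namespace Literature.AlgebraicGeometry.Resolution.WeightedBlowup

variable {R : Type*} [CommRing R] {H L : Type*}

/-! ## §1 Coefficient derivations: a derivation of `A[ε_L]` killing the `ε_L` is a family of derivations of `A` -/

section CoeffDerivation

variable (X : Derivation R (MvPolynomial L (MvPolynomial H R)) (MvPolynomial L (MvPolynomial H R)))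

/-- The coefficient derivation `Z^{(κ)}` of `X` at the `L`-monomial `κ`: `a ↦` the `ε_L^κ`-coefficient of `X(a)`
for `a ∈ A = R[ε_H]` (viewed in `A[ε_L]` as a constant).  It is an `R`-derivation of `A` because
`X(ab) = a·X(b) + b·X(a)` and taking the `κ`-coefficient is `A`-linear. (model: the cell's LEMMA CF (1), `Z^{(κ)}`)
[cite: Matsumura1987, §25 (derivations; `Der_R(R[X]) ≅ ⊕ R[X]·∂/∂X_i`)] -/
def coeffDerivation (κ : L →₀ ℕ) : Derivation R (MvPolynomial H R) (MvPolynomial H R) where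
  toFun a := coeff κ (X (C a))
  map_add' a b := by simp only [map_add, coeff_add]
  map_smul' r a := by
    dsimp only [RingHom.id_apply]
    rw [← coeff_smul, ← Derivation.map_smul]
    congr 2
    rw [smul_eq_C_mul, map_mul, Algebra.smul_def,
      IsScalarTower.algebraMap_apply R (MvPolynomial H R) (MvPolynomial L (MvPolynomial H R)),
      MvPolynomial.algebraMap_eq, MvPolynomial.algebraMap_eq]
  map_one_eq_zero' := by
    simp only [LinearMap.coe_mk, AddHom.coe_mk, map_one, Derivation.map_one_eq_zero, coeff_zero]
  leibniz' a b := by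
    simp only [LinearMap.coe_mk, AddHom.coe_mk, map_mul, Derivation.leibniz, smul_eq_mul, coeff_add,
      coeff_C_mul]

/-- Unfolding: `Z^{(κ)}(a) = coeff_κ X(a)`. (plumbing, derived here)
[cite: Matsumura1987, §25 (derivations of polynomial rings)] -/
@[simp] theorem coeffDerivation_apply (κ : L →₀ ℕ) (a : MvPolynomial H R) :
    coeffDerivation X κ a = coeff κ (X (C a)) := rfl

/-- `Z^{(κ)} = Σ_i ξ_i^{(κ)} ∂_i` with `ξ_i^{(κ)}` the `κ`-coefficient of `ξ_i = X(ε_i)`: a derivation of a polynomial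
ring is determined by its values on the variables. (derived here)
[cite: Matsumura1987, §25 (derivations of polynomial rings)] -/
theorem coeffDerivation_eq_mkDerivation (κ : L →₀ ℕ) :
    coeffDerivation X κ = mkDerivation R fun i => coeff κ (X (C (MvPolynomial.X i))) :=
  derivation_ext fun i => by rw [coeffDerivation_apply, mkDerivation_X]

variable {X}

/-- A derivation killing every `ε_l` kills every `L`-monomial. (derived here)
[cite: Matsumura1987, §25 (derivations of polynomial rings)] -/
theorem apply_monomial_one_eq_zero (hX : ∀ l, X (MvPolynomial.X l) = 0) (κ : L →₀ ℕ) :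
    X (monomial κ 1) = 0 := by
  induction κ using Finsupp.induction with
  | zero => exact X.map_one_eq_zero
  | single_add l n κ _ _ ih =>
    rw [monomial_single_add, Derivation.leibniz, ih, smul_zero, zero_add, Derivation.leibniz_pow, hX,
      smul_zero, smul_zero, smul_zero]

/-- … hence commutes with multiplication by `L`-monomials: `X(ε_L^κ · g) = ε_L^κ · X(g)`. (derived here)
[cite: Matsumura1987, §25 (derivations of polynomial rings)] -/
theorem apply_monomial_one_mul (hX : ∀ l, X (MvPolynomial.X l) = 0) (κ : L →₀ ℕ)
    (g : MvPolynomial L (MvPolynomial H R)) :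
    X (monomial κ 1 * g) = monomial κ 1 * X g := by
  rw [Derivation.leibniz, apply_monomial_one_eq_zero hX, smul_zero, add_zero, smul_eq_mul]

/-- **The convolution formula** (identity level, any ring).  If `X` kills the `ε_L`, then for every `g = Σ_μ ε_L^μ g_μ`
(`g_μ ∈ A`):  `coeff_ν X(g) = Σ_{κ + μ = ν} Z^{(κ)}(g_μ)` — i.e. `X = Σ_κ ε_L^κ · Z^{(κ)}` acting coefficientwise.
(derived here; the displayed expansion in the proof of the cell's LEMMA CF (1))
[cite: Matsumura1987, §25 (derivations of polynomial rings)] -/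
theorem coeff_apply_eq_sum_antidiagonal [DecidableEq L] (hX : ∀ l, X (MvPolynomial.X l) = 0)
    (g : MvPolynomial L (MvPolynomial H R)) (ν : L →₀ ℕ) :
    coeff ν (X g) = ∑ x ∈ Finset.antidiagonal ν, coeffDerivation X x.1 (coeff x.2 g) := by
  classical
  induction g using MvPolynomial.induction_on' with
  | monomial μ a =>
    have hmon : (monomial μ a : MvPolynomial L (MvPolynomial H R)) = monomial μ 1 * C a := by
      rw [mul_comm, C_mul_monomial, mul_one]
    rw [hmon, apply_monomial_one_mul hX, coeff_monomial_mul', one_mul]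
    simp_rw [← hmon, coeff_monomial]
    split_ifs with h
    · rw [Finset.sum_eq_single (ν - μ, μ)]
      · rw [if_pos rfl, coeffDerivation_apply]
      · intro x hx hne
        rw [if_neg, map_zero]
        intro hμ
        apply hne
        rw [Finset.mem_antidiagonal] at hx
        rw [Prod.ext_iff]
        refine ⟨?_, hμ.symm⟩
        rw [← hx, ← hμ, add_tsub_cancel_right]
      · intro hnot
        exact absurd (Finset.mem_antidiagonal.mpr (tsub_add_cancel_of_le h)) hnot
    · refine (Finset.sum_eq_zero fun x hx => ?_).symm
      rw [if_neg, map_zero]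
      intro hμ
      rw [Finset.mem_antidiagonal] at hx
      exact h (hx ▸ hμ ▸ le_add_left le_rfl)
  | add p q hp hq =>
    simp only [map_add, coeff_add, hp, hq, Finset.sum_add_distrib]

/-- The `β = 0` case (no hypothesis on the coefficients): the constant term of `X(g)` is `Z^{(0)}` applied to the
constant term of `g` — "`Z` is the `L`-free part of `X` restricted to `H`". (derived here; LEMMA CF REMARK (b))
[cite: Matsumura1987, §25 (derivations of polynomial rings)] -/
theorem coeff_zero_apply [DecidableEq L] (hX : ∀ l, X (MvPolynomial.X l) = 0) (g : MvPolynomial L (MvPolynomial H R)) :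
    coeff 0 (X g) = coeffDerivation X 0 (coeff 0 g) := by
  rw [coeff_apply_eq_sum_antidiagonal hX, Finsupp.antidiagonal_zero, Finset.sum_singleton]

/-- **LEMMA CF (1) (identity level).**  If `Z^{(κ)} = 0` for every PROPER divisor `κ` of `κ₀` (in the application:
every `κ` with `Z^{(κ)} ≠ 0` weighs at least `β = weight κ₀`, by the numerical condition (GAP)), then the
`ε_L^{κ₀}`-coefficient of `X(g)` is `Z^{(κ₀)}(G_H)`, `G_H := g|_{ε_L = 0}` the constant term. (derived here)
[cite: Matsumura1987, §25 (derivations of polynomial rings)] -/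
theorem coeff_apply_of_forall_lt_eq_zero [DecidableEq L] (hX : ∀ l, X (MvPolynomial.X l) = 0) {κ₀ : L →₀ ℕ}
    (hmin : ∀ κ, κ ≤ κ₀ → κ ≠ κ₀ → coeffDerivation X κ = 0) (g : MvPolynomial L (MvPolynomial H R)) :
    coeff κ₀ (X g) = coeffDerivation X κ₀ (coeff 0 g) := by
  classical
  rw [coeff_apply_eq_sum_antidiagonal hX]
  rw [Finset.sum_eq_single (κ₀, 0)]
  · rintro ⟨κ, μ⟩ hx hne
    rw [Finset.mem_antidiagonal] at hx
    dsimp only at hx ⊢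
    have hκ : κ ≠ κ₀ := by
      rintro rfl
      apply hne
      have : μ = 0 := by simpa using hx
      rw [this]
    rw [hmin κ (hx ▸ le_add_right le_rfl) hκ, Derivation.zero_apply]
  · intro h
    exact absurd (by rw [Finset.mem_antidiagonal, add_zero]) h

/-- Consequently `X(g) = 0 ⇒ Z^{(κ₀)}(G_H) = 0`: the restricted face is killed by a derivation of `R[ε_H]` whose
coefficients are the `κ₀`-coefficients of the `ξ_i` (CONSTANTS on the lightest moved class in the graded setting —
"constant-field restriction"). (derived here; the cell's LEMMA CF (1))
[cite: Matsumura1987, §25 (derivations of polynomial rings)] -/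
theorem coeffDerivation_coeff_zero_eq_zero [DecidableEq L] (hX : ∀ l, X (MvPolynomial.X l) = 0) {κ₀ : L →₀ ℕ}
    (hmin : ∀ κ, κ ≤ κ₀ → κ ≠ κ₀ → coeffDerivation X κ = 0) {g : MvPolynomial L (MvPolynomial H R)}
    (hg : X g = 0) : coeffDerivation X κ₀ (coeff 0 g) = 0 := by
  rw [← coeff_apply_of_forall_lt_eq_zero hX hmin g, hg, coeff_zero]

end CoeffDerivation

/-! ### Graded form of the minimality hypothesis

In LEMMA CF the `L`-variables carry positive rational weights, `κ₀` has weight `β`, and the numerical condition (GAP)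
guarantees that `Z^{(κ)} = 0` whenever `weight κ < β`; since a proper divisor of `κ₀` weighs strictly less than
`κ₀`, the divisibility-minimality used above follows. -/

section Graded

open Finsupp (weight)

/-- With strictly positive weights, a proper divisor of an exponent vector weighs strictly less. (plumbing, derived
here) [cite: Matsumura1987, §25 (derivations of polynomial rings; graded bookkeeping is folklore)] -/
theorem weight_lt_weight_of_le_of_ne {w : L → ℚ} (hw : ∀ l, 0 < w l) {κ κ₀ : L →₀ ℕ} (hle : κ ≤ κ₀)
    (hne : κ ≠ κ₀) : weight w κ < weight w κ₀ := by
  have hdec : κ₀ = κ + (κ₀ - κ) := (add_tsub_cancel_of_le hle).symm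
  have hne' : κ₀ - κ ≠ 0 := by
    intro h
    apply hne
    rw [hdec, h, add_zero]
  obtain ⟨l, hl⟩ : ∃ l, (κ₀ - κ) l ≠ 0 := by
    by_contra hall
    simp only [not_exists, not_not] at hall
    exact hne' (Finsupp.ext hall)
  have hpos : 0 < weight w (κ₀ - κ) :=
    lt_of_lt_of_le (hw l) (Finsupp.le_weight_of_ne_zero (fun s => (hw s).le) hl)
  rw [hdec, map_add]
  exact lt_add_of_pos_right _ hpos

variable {X : Derivation R (MvPolynomial L (MvPolynomial H R)) (MvPolynomial L (MvPolynomial H R))}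

/-- **LEMMA CF (1), graded form.**  If `X` kills the `ε_L`, the `L`-weights are positive, and every coefficient
derivation `Z^{(κ)}` with `weight κ < weight κ₀` vanishes (the conclusion the cell draws from (GAP): "every element
of `K = {κ : Z^{(κ)} ≠ 0}` weighs `≥ β`"), then `coeff_{κ₀} X(g) = Z^{(κ₀)}(g|_{ε_L = 0})`. (derived here; the
cell's LEMMA CF (1))
[cite: Matsumura1987, §25 (derivations of polynomial rings)] -/
theorem coeff_apply_of_weight_lt [DecidableEq L] (hX : ∀ l, X (MvPolynomial.X l) = 0) {w : L → ℚ}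
    (hw : ∀ l, 0 < w l) {κ₀ : L →₀ ℕ}
    (hK : ∀ κ, weight w κ < weight w κ₀ → coeffDerivation X κ = 0) (g : MvPolynomial L (MvPolynomial H R)) :
    coeff κ₀ (X g) = coeffDerivation X κ₀ (coeff 0 g) :=
  coeff_apply_of_forall_lt_eq_zero hX
    (fun κ hle hne => hK κ (weight_lt_weight_of_le_of_ne hw hle hne)) g

/-- The graded vanishing statement: `X(g) = 0 ⇒ Z^{(κ₀)}(G_H) = 0`. (derived here; the cell's LEMMA CF (1))
[cite: Matsumura1987, §25 (derivations of polynomial rings)] -/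
theorem coeffDerivation_coeff_zero_eq_zero_of_weight_lt [DecidableEq L] (hX : ∀ l, X (MvPolynomial.X l) = 0)
    {w : L → ℚ} (hw : ∀ l, 0 < w l) {κ₀ : L →₀ ℕ}
    (hK : ∀ κ, weight w κ < weight w κ₀ → coeffDerivation X κ = 0) {g : MvPolynomial L (MvPolynomial H R)}
    (hg : X g = 0) : coeffDerivation X κ₀ (coeff 0 g) = 0 :=
  coeffDerivation_coeff_zero_eq_zero hX (fun κ hle hne => hK κ (weight_lt_weight_of_le_of_ne hw hle hne)) hg

end Graded

/-! ## §2 The truncated exponential of a derivation with a slice (rectification, LEMMA CF (2))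

For a derivation `Z` of a commutative `R`-algebra `S` and `u ∈ S` with `Z(u) = 1` (a SLICE; in LEMMA CF,
`u = ε_{i₀}/r_{i₀}`), the exponential `π(f) = Σ_n (−u)^n Z^n(f)/n!` is the classical projector onto `ker Z` with
`S = (ker Z)[u]` (characteristic `0`: the Dixmier–Rentschler map; in characteristic `p` the rôle of `exp` is played
by exponential maps = locally finite iterative higher derivations, [VandenessenKurodaCrachiola2021, Ch. 3 §3.2,
Cor. 3.2.10]).  The cell needs it only TRUNCATED below `p` and only on generators: we use the factorial-free
normalisation `E_N(f) := Σ_{n<N} ((N−1)!/n!)·(−u)^n Z^n(f)`, defined by the recursion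
`E_{N+1}(f) = N·E_N(f) + (−u)^N Z^N(f)`, which satisfies the TELESCOPING IDENTITY `Z(E_{N+1} f) = (−u)^N Z^{N+1}(f)`
over any commutative ring.  So `Z^{N+1}(f) = 0 ⇒ E_{N+1}(f) ∈ ker Z`, and `E_{N+1}(f) = N!·f + u·(…)`: when `N! ∈ S^×`
(`N < p`), `π(f) := E_{N+1}(f)/N!` is `f` corrected by a multiple of `u` — the graded coordinate change `ε ↦ ε''` of
LEMMA CF (2) / T9 LEMMA D (4). -/

section TruncExp

variable {S : Type*} [CommRing S] [Algebra R S] (Z : Derivation R S S) (u : S)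

/-- The factorial-free truncated exponential `E_N(f) = Σ_{n<N} ((N−1)!/n!)·(−u)^n·Z^n(f)`, by the recursion
`E_0 = 0`, `E_{N+1}(f) = N·E_N(f) + (−u)^N·Z^N(f)`. (model: the rectification `π` of the cell's LEMMA CF (2) /
T9 LEMMA D (4), up to the factor `N!`)
[cite: VandenessenKurodaCrachiola2021, Ch. 3 §3.2 (exponential maps; Cor. 3.2.10: a slice `s` gives `A = A^δ[s]`)] -/
def truncExp : ℕ → S → S
  | 0, _ => 0
  | N + 1, f => N • truncExp N f + (-u) ^ N * (⇑Z)^[N] f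

/-- `E_0 = 0`. (plumbing) [cite: VandenessenKurodaCrachiola2021, Ch. 3 §3.2] -/
@[simp] theorem truncExp_zero (f : S) : truncExp Z u 0 f = 0 := rfl

/-- The recursion `E_{N+1}(f) = N·E_N(f) + (−u)^N Z^N(f)`. (plumbing)
[cite: VandenessenKurodaCrachiola2021, Ch. 3 §3.2] -/
theorem truncExp_succ (N : ℕ) (f : S) :
    truncExp Z u (N + 1) f = N • truncExp Z u N f + (-u) ^ N * (⇑Z)^[N] f := rfl

/-- `E_1(f) = f`. (plumbing) [cite: VandenessenKurodaCrachiola2021, Ch. 3 §3.2] -/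
@[simp] theorem truncExp_one (f : S) : truncExp Z u 1 f = f := by
  simp [truncExp_succ]

/-- `E_2(f) = f − u·Z(f)` (the first-order correction `ε_i ↦ ε_i − u·Z(ε_i)`). (plumbing)
[cite: VandenessenKurodaCrachiola2021, Ch. 3 §3.2] -/
theorem truncExp_two (f : S) : truncExp Z u 2 f = f - u * Z f := by
  simp [truncExp_succ, sub_eq_add_neg]

/-- **Telescoping identity.**  If `Z(u) = 1` then `Z(E_{N+1}(f)) = (−u)^N · Z^{N+1}(f)` for every `N` and `f`,
over ANY commutative ring (no factorials are inverted). (derived here)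
[cite: VandenessenKurodaCrachiola2021, Ch. 3 §3.2 (exponential maps; Cor. 3.2.10)] -/
theorem apply_truncExp_succ (hu : Z u = 1) (N : ℕ) (f : S) :
    Z (truncExp Z u (N + 1) f) = (-u) ^ N * (⇑Z)^[N + 1] f := by
  induction N with
  | zero => simp
  | succ N ih =>
    rw [truncExp_succ, map_add, map_nsmul, ih, Derivation.leibniz, Derivation.leibniz_pow, map_neg, hu,
      smul_eq_mul, smul_eq_mul, Function.iterate_succ_apply' (⇑Z) (N + 1) f, Nat.add_sub_cancel,
      nsmul_eq_mul, nsmul_eq_mul, smul_eq_mul]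
    ring

/-- Hence `Z^{N+1}(f) = 0 ⇒ Z(E_{N+1}(f)) = 0`: the truncated exponential of an element of finite `Z`-order lies
in `ker Z` (in LEMMA CF (2): `Z(ε''_i) = 0` for `i ≠ i₀`, the order being `≤ w_i/w₀ ≤ 1/(2w₀) < p` by weights).
(derived here; the cell's LEMMA CF (2) / T9 LEMMA D (4) "telescoping")
[cite: VandenessenKurodaCrachiola2021, Ch. 3 §3.2 (Cor. 3.2.10)] -/
theorem apply_truncExp_succ_eq_zero (hu : Z u = 1) {N : ℕ} {f : S} (hN : (⇑Z)^[N + 1] f = 0) :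
    Z (truncExp Z u (N + 1) f) = 0 := by
  rw [apply_truncExp_succ Z u hu, hN, mul_zero]

/-- **Leading term.**  `E_{N+1}(f) = N!·f + u·v` for some `v`: after dividing by `N!` (a unit when `N < p`) the new
coordinate `π(ε_i)` is `ε_i` plus a multiple of `u` — a unitriangular change. (derived here)
[cite: VandenessenKurodaCrachiola2021, Ch. 3 §3.2 (Cor. 3.2.10: `A = A^δ[s]`)] -/
theorem exists_truncExp_succ_eq (N : ℕ) (f : S) :
    ∃ v : S, truncExp Z u (N + 1) f = (N.factorial : S) * f + u * v := by
  induction N with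
  | zero => exact ⟨0, by simp⟩
  | succ N ih =>
    obtain ⟨v, hv⟩ := ih
    refine ⟨(N + 1 : ℕ) • v + (-1) ^ (N + 1) * u ^ N * (⇑Z)^[N + 1] f, ?_⟩
    rw [truncExp_succ, hv, Nat.factorial_succ, nsmul_eq_mul, nsmul_eq_mul, Nat.cast_mul]
    ring

/-- The slice normalisation: if `Z(e) = r·1` with `r` a unit of `R` (in LEMMA CF: `Z(ε_{i₀}) = r_{i₀} ∈ k^×`, a
CONSTANT by part (1)), then `u := r⁻¹·e` has `Z(u) = 1`. (plumbing, derived here)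
[cite: VandenessenKurodaCrachiola2021, Ch. 3 §3.2 (slices)] -/
theorem apply_units_inv_smul (r : Rˣ) {e : S} (he : Z e = algebraMap R S r) :
    Z ((↑r⁻¹ : R) • e) = 1 := by
  rw [Derivation.map_smul, he, Algebra.smul_def, ← map_mul, Units.inv_mul, map_one]

end TruncExp

/-! ## §3 The chain rule and the conclusion of LEMMA CF (2): `∂𝒢/∂ε''_{i₀} = 0`

If the new coordinates `ε'' = (φ_i)` satisfy `Z(φ_i) = 0` for `i ≠ i₀`, then for `G_H = 𝒢(ε'')` the chain rule gives
`Z(G_H) = (∂_{i₀}𝒢)(ε'')·Z(φ_{i₀})`; so `Z(G_H) = 0`, `Z(φ_{i₀})` a unit and `𝒢 ↦ 𝒢(ε'')` injective force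
`∂_{i₀}𝒢 = 0`, i.e. in characteristic `p` every exponent of `ε''_{i₀}` in `𝒢` is a multiple of `p`:
`𝒢 ∈ k[ε''_{H∖i₀}][(ε''_{i₀})^p]` — the normal form from which LEMMA CF (3) reads off the pins. -/

section ChainRule

variable {S : Type*} [CommRing S] [Algebra R S] (Z : Derivation R S S) {ι : Type*} [Fintype ι]

/-- **Chain rule** for a derivation through a substitution: `Z(G(φ)) = Σ_i (∂_i G)(φ) · Z(φ_i)`. (derived here)
[cite: Matsumura1987, §25 (derivations of polynomial rings; `dG = Σ ∂_i G dX_i`)] -/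
theorem apply_aeval_eq_sum (φ : ι → S) (G : MvPolynomial ι R) :
    Z (aeval φ G) = ∑ i, aeval φ (pderiv i G) * Z (φ i) := by
  classical
  induction G using MvPolynomial.induction_on with
  | C a => simp
  | add p q hp hq => simp only [map_add, hp, hq, add_mul, Finset.sum_add_distrib]
  | mul_X p i hp =>
    have key : ∀ x, aeval φ (pderiv x (p * X i)) * Z (φ x) =
        φ i * (aeval φ (pderiv x p) * Z (φ x)) + (if i = x then aeval φ p * Z (φ x) else 0) := by
      intro x
      rw [Derivation.leibniz, smul_eq_mul, smul_eq_mul, pderiv_X, Pi.single_apply, map_add, map_mul, map_mul,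
        aeval_X]
      split_ifs with h1
      · simp; ring
      · simp; ring
    rw [Finset.sum_congr rfl fun x _ => key x, Finset.sum_add_distrib, Finset.sum_ite_eq,
      if_pos (Finset.mem_univ _), ← Finset.mul_sum, ← hp, map_mul, aeval_X, Derivation.leibniz, smul_eq_mul,
      smul_eq_mul]
    ring

/-- If `Z` kills all new coordinates but `φ_{i₀}`: `Z(G(φ)) = (∂_{i₀} G)(φ) · Z(φ_{i₀})`. (derived here; the display
`0 = Z(G_H) = r_{i₀}·(∂𝒢/∂ε''_{i₀})(ε'')` of the cell's LEMMA CF (2))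
[cite: Matsumura1987, §25 (derivations of polynomial rings)] -/
theorem apply_aeval_of_forall_ne_eq_zero {φ : ι → S} {i₀ : ι} (h0 : ∀ i, i ≠ i₀ → Z (φ i) = 0)
    (G : MvPolynomial ι R) : Z (aeval φ G) = aeval φ (pderiv i₀ G) * Z (φ i₀) := by
  rw [apply_aeval_eq_sum, Finset.sum_eq_single i₀ (fun i _ hi => by rw [h0 i hi, mul_zero])
    (fun h => absurd (Finset.mem_univ _) h)]

/-- **LEMMA CF (2), conclusion.**  If moreover `Z(G(φ)) = 0`, `Z(φ_{i₀})` is a unit and the substitution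
`G ↦ G(φ)` is injective (a coordinate change), then `∂_{i₀} G = 0`. (derived here; the cell's LEMMA CF (2))
[cite: Matsumura1987, §25 (derivations of polynomial rings)] -/
theorem pderiv_eq_zero_of_apply_aeval_eq_zero {φ : ι → S} {i₀ : ι} (h0 : ∀ i, i ≠ i₀ → Z (φ i) = 0)
    (hunit : IsUnit (Z (φ i₀))) (hinj : Function.Injective (aeval φ : MvPolynomial ι R → S))
    {G : MvPolynomial ι R} (hG : Z (aeval φ G) = 0) : pderiv i₀ G = 0 := by
  rw [apply_aeval_of_forall_ne_eq_zero Z h0] at hG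
  have h1 : aeval φ (pderiv i₀ G) = 0 := (hunit.mul_left_eq_zero).mp hG
  exact hinj (by rw [h1, map_zero])

/-- The chain rule through the identity substitution: every derivation of a polynomial ring in finitely many
variables is `Z = Σ_i Z(ε_i)·∂_i`, i.e. `Z(G) = Σ_i ∂_i G · Z(ε_i)`. (derived here)
[cite: Matsumura1987, §25 (derivations of polynomial rings; `Der_R(R[X]) ≅ ⊕ R[X]·∂/∂X_i`)] -/
theorem derivation_apply_eq_sum_pderiv_mul (D : Derivation R (MvPolynomial ι R) (MvPolynomial ι R))
    (G : MvPolynomial ι R) : D G = ∑ i, pderiv i G * D (X i) := by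
  have h := apply_aeval_eq_sum D X G
  simp only [aeval_X_left, AlgHom.coe_id, id_eq] at h
  exact h

/-- Bridge to `WeightedCentreCleanLayers`: the layer derivation `L_s = Σ_i a_{s,i} ∂_i` of a substitution
`ε ↦ ε + Δ(σ)` IS the derivation `mkDerivation R (a_{s,·})` of `R[ε]` — so §1 applies to clean layers
(`coeff_layerSubst_eq_layerDeriv`, `layerDeriv_eq_zero_of_layerSubst_eq`). (derived here)
[cite: CossartJannsenSaito2020, Ch. 14, proof of Lemma 14.10 (p. 170) (Hasse derivations `D_A`)] -/
theorem layerDeriv_eq_mkDerivation_apply (Δ : ι → Polynomial (MvPolynomial ι R)) (s : ℕ)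
    (g : MvPolynomial ι R) : layerDeriv Δ s g = mkDerivation R (fun i => (Δ i).coeff s) g := by
  rw [layerDeriv, derivation_apply_eq_sum_pderiv_mul]
  refine Finset.sum_congr rfl fun i _ => ?_
  rw [mkDerivation_X, mul_comm]

end ChainRule

section CharP

variable {k : Type*} [Field k] {ι : Type*} [Fintype ι] {S : Type*} [CommRing S] [Algebra k S]
  (Z : Derivation k S S)

/-- **LEMMA CF (2), normal form in characteristic `p`.**  Under the hypotheses of
`pderiv_eq_zero_of_apply_aeval_eq_zero`, in characteristic `p` every exponent of the distinguished variable in `G`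
is divisible by `p`: `G ∈ k[ε''_{≠ i₀}][(ε''_{i₀})^p]`. (derived here; the cell's LEMMA CF (2), last display)
[cite: Hironaka1970AdditiveGroups, additive forms and differential operators] -/
theorem dvd_of_apply_aeval_eq_zero (p : ℕ) [CharP k p] {φ : ι → S} {i₀ : ι}
    (h0 : ∀ i, i ≠ i₀ → Z (φ i) = 0) (hunit : IsUnit (Z (φ i₀)))
    (hinj : Function.Injective (aeval φ : MvPolynomial ι k → S)) {G : MvPolynomial ι k}
    (hG : Z (aeval φ G) = 0) {d : ι →₀ ℕ} (hd : d ∈ G.support) : p ∣ d i₀ :=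
  dvd_of_pderiv_eq_zero p (pderiv_eq_zero_of_apply_aeval_eq_zero Z h0 hunit hinj hG) hd

end CharP

/-! ## §4 Frobenius is invisible to derivations (LEMMA FP (ii), the identity-level input)

In characteristic `p` every derivation kills `p`-th powers; so if a substitution changes `g₀` only by `c·ℓ^p`
(`g₀ ∘ Ψ̄ = g₀ − c·ℓ^p`, the FROBENIUS PIN situation of the cell's LEMMA FP), every derivation read off the
substitution — log-derivative components, clean layers (`layerDeriv`, `WeightedCentreCleanLayers`) — treats `g₀` as
an invariant. -/

section Frobenius

/-- A derivation kills `p`-th powers in characteristic `p`: `D(a^p) = p·a^{p-1}·D(a) = 0`. (derived here)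
[cite: VandenessenKurodaCrachiola2021, Ch. 3 §3.2 ("the kernel of any derivation will contain the pth power of every element")] -/
theorem derivation_apply_pow_char_eq_zero {A M : Type*} [CommRing A] [Algebra R A] [AddCommGroup M] [Module A M]
    [Module R M] (p : ℕ) [CharP A p] (D : Derivation R A M) (a : A) : D (a ^ p) = 0 := by
  rw [D.leibniz_pow, ← Nat.cast_smul_eq_nsmul A, CharP.cast_eq_zero, zero_smul]

/-- … so a `p`-th power perturbation is invisible: `D(g + c·ℓ^p) = D(g)`. (derived here; the cell's LEMMA FP (ii):
"`∂_σ(g₀ − cℓ^p) = −c·p·ℓ^{p−1}∂_σℓ = 0`" — HERE for constant `c`; for general `c` one gets `D(g) + ℓ^p·D(c)`)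
[cite: VandenessenKurodaCrachiola2021, Ch. 3 §3.2] -/
theorem derivation_apply_add_mul_pow_char {A M : Type*} [CommRing A] [Algebra R A] [AddCommGroup M]
    [Module A M] [Module R M] (p : ℕ) [CharP A p] (D : Derivation R A M) (g c ℓ : A) :
    D (g + c * ℓ ^ p) = D g + ℓ ^ p • D c := by
  rw [map_add, D.leibniz, derivation_apply_pow_char_eq_zero p D ℓ, smul_zero, zero_add]

/-- In particular with a constant coefficient `c ∈ R`: `D(g + c·ℓ^p) = D(g)`. (derived here; the cell's LEMMA FP (ii))
[cite: VandenessenKurodaCrachiola2021, Ch. 3 §3.2] -/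
theorem derivation_apply_add_C_mul_pow_char {A M : Type*} [CommRing A] [Algebra R A] [AddCommGroup M]
    [Module A M] [Module R M] [IsScalarTower R A M] (p : ℕ) [CharP A p] (D : Derivation R A M) (g ℓ : A) (c : R) :
    D (g + algebraMap R A c * ℓ ^ p) = D g := by
  rw [derivation_apply_add_mul_pow_char p D, D.map_algebraMap, smul_zero, add_zero]

end Frobenius

/-! ## §5 Frobenius absorption (LEMMA FA, the identity-level core)

In characteristic `p` the substitution `ε_v ↦ ε_v + Σ_M a_M·N_M` changes `c·ε_v^p` by `Σ_M (c·a_M^p)·N_M^p` and by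
NOTHING ELSE (no cross terms: Frobenius is additive), so choosing `c·a_M^p = −g_M` deletes the `p`-th-power pins
`g_M·N_M^p` — the step FA of the cell's normal-form algorithm (THEOREM Θ(vi) §3bis); the remaining content of
LEMMA FA is bookkeeping about supports and is not typed here. -/

section FrobeniusAbsorption

variable {A : Type*} [CommRing A] (p : ℕ) [Fact p.Prime] [CharP A p]

/-- `(x + Σ_i a_i N_i)^p = x^p + Σ_i a_i^p N_i^p` in characteristic `p`. (derived here)
[cite: Hironaka1970AdditiveGroups, additive forms and differential operators] -/
theorem add_sum_mul_pow_char {ι : Type*} (s : Finset ι) (x : A) (a N : ι → A) :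
    (x + ∑ i ∈ s, a i * N i) ^ p = x ^ p + ∑ i ∈ s, a i ^ p * N i ^ p := by
  rw [add_pow_char, sum_pow_char]
  simp [mul_pow]

/-- **Frobenius absorption.**  If `c·a_i^p = −g_i` for every `i ∈ s`, then substituting `x + Σ_i a_i N_i` for `x`
in `c·x^p + Σ_i g_i N_i^p` leaves exactly `c·x^p`. (derived here; the cell's LEMMA FA, identity level)
[cite: Hironaka1970AdditiveGroups, additive forms and differential operators] -/
theorem frobenius_absorption {ι : Type*} (s : Finset ι) (x c : A) (a N g : ι → A)
    (h : ∀ i ∈ s, c * a i ^ p = -g i) :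
    c * (x + ∑ i ∈ s, a i * N i) ^ p + ∑ i ∈ s, g i * N i ^ p = c * x ^ p := by
  rw [add_sum_mul_pow_char p, mul_add, Finset.mul_sum, add_assoc, ← Finset.sum_add_distrib]
  have hz : ∀ i ∈ s, c * (a i ^ p * N i ^ p) + g i * N i ^ p = 0 := by
    intro i hi
    rw [← mul_assoc, h i hi]
    ring
  rw [Finset.sum_eq_zero hz, add_zero]

/-- The polynomial form: for `P = k[ε_σ]`, `char k = p`, constants `c, a_i ∈ k` with `c·a_i^p = −g_i` (possible over
a perfect field whenever the `g_i` are constants), the substitution `ε_v ↦ ε_v + Σ_i a_i·N_i` absorbs the pins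
`Σ_i g_i·N_i^p` into `c·ε_v^p`. (derived here; the cell's LEMMA FA / instrument step `step_FA`)
[cite: Hironaka1970AdditiveGroups, additive forms and differential operators] -/
theorem frobenius_absorption_mvPolynomial {σ k : Type*} [CommRing k] [CharP k p] {ι : Type*} (s : Finset ι)
    (v : σ) (c : k) (a : ι → k) (N g : ι → MvPolynomial σ k)
    (h : ∀ i ∈ s, (C c : MvPolynomial σ k) * C (a i) ^ p = -g i) :
    C c * (X v + ∑ i ∈ s, C (a i) * N i) ^ p + ∑ i ∈ s, g i * N i ^ p = C c * X v ^ p :=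
  frobenius_absorption p s (X v) (C c) (fun i => C (a i)) N g h

end FrobeniusAbsorption

end Literature.AlgebraicGeometry.Resolution.WeightedBlowup
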